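import Literature.Probability.RandomPlanarGeometry.SLETransienceLemma73
import Literature.Probability.RandomPlanarGeometry.SLETransienceKappaEight
import Literature.Probability.RandomPlanarGeometry.SLEHullBoundaryAreaLargeKappa
import Literature.Probability.RandomPlanarGeometry.RohdeSchrammCor35Proofs
import HarnessLib

/-!
# Rohde–Schramm (2005), Lemma 7.3 for `κ > 8`: the named fact from Thm. 5.1 and Cor. 5.3

Trunk T-STOCH. Assembly of the branch `κ > 8` of the named fact `RohdeSchramm2005_lem73`
(`SLETransience.lean`; S. Rohde, O. Schramm, *Basic properties of SLE*, Ann. of Math. 161 (2005),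
Lemma 7.3, p. 910: "Suppose that `κ > 4`, `κ ≠ 8`, and let `t > 0`. Then a.s. there is some `ε > 0`
such that `Kₜ ⊃ {z ∈ ℍ : |z| < ε}`") from the two files that prove its printed proof:

* `SLETransienceKappaEight.lean` proves the `κ > 8` argument of p. 910 (for every `κ ≥ 8` whose
  chain is a.s. generated by a curve): if, for every `t`, almost surely `area(∂Kₜ) = 0`
  (Rohde–Schramm's **Cor. 5.3**, the only input not proved in the tree, hypothesis `hbd`), then it
  is absurd that a.s. `0 ∈ cl H₁` (`ae_volume_sleHull_eq_zero_of_frontier`,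
  `not_forall_ae_volume_sleHull_eq_zero`); here this is recorded as the positive probability of a
  sealed half-disc at time `1` (`measure_halfDisc_sleHull_one_ne_zero_of_frontier_null`);
* `SLETransienceLemma73.lean` proves the end of the argument ("By scale invariance, `p₀` is a
  constant not depending on `t` … By Blumenthal's 0-1 law, `p₀ ∈ {0, 1}`"): a sealed half-disc with
  positive probability at one time is sealed almost surely at every positive time
  (`ae_exists_halfDisc_subset_sleHull_of_measure_ne_zero`), and the branch `4 < κ < 8` from
  Thm. 5.1 (`RohdeSchramm2005_lem73_of_lt_eight`).

Results: `ae_exists_halfDisc_subset_sleHull_of_frontier_null` (Lemma 7.3 for every `κ ≥ 8` with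
`HasSLETrace κ`, from Cor. 5.3 at `κ`; this includes `κ = 8` given [LSW] Thm. 4.7, as the Update
on p. 911 asserts) and `RohdeSchramm2005_lem73_of_thm51_of_cor53`: **the named fact
`RohdeSchramm2005_lem73` follows from Thm. 5.1 (`hasSLETrace_of_ne_eight`) and Cor. 5.3 for
`κ > 8`** (hypothesis `hbd`; Cor. 5.3 — "For `κ ≠ 4` and every `t`, … `dim ∂Kₜ < 2`. In
particular, a.s. `area ∂Kₜ = 0`", proved in the source from Thm. 5.2 and Jones–Makarov — is not
a named fact of the tree and is not introduced here).

**Discharge.** Both inputs are now theorems of the tree: Thm. 5.1 is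
`hasSLETrace_of_ne_eight_holds` (`RohdeSchrammCor35Proofs.lean`, from Cor. 3.5 proved there,
`RohdeSchramm2005_cor35_holds`), and Cor. 5.3 for every `κ ≥ 8` whose chain is a.s. generated by a
curve is `ae_volume_frontier_sleHull_eq_zero_of_cor35` (`SLEHullBoundaryAreaLargeKappa.lean`, from
Cor. 3.5). Hence `ae_exists_halfDisc_subset_sleHull_of_eight_le` (Lemma 7.3 for every `κ ≥ 8` with
`HasSLETrace κ` — at `κ = 8` this is the Update, p. 911, given [LSW] Thm. 4.7) and the closed
discharge **`RohdeSchramm2005_lem73_holds : RohdeSchramm2005_lem73`**.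

## References

* S. Rohde, O. Schramm, *Basic properties of SLE*, Ann. of Math. 161 (2005) 883–924: Lemma 7.3
  and its proof (p. 910), Cor. 5.3 (§5), Thm. 5.1, Update (p. 911).
* G. F. Lawler, O. Schramm, W. Werner, *Conformal invariance of planar loop-erased random walks
  and uniform spanning trees*, Ann. Probab. 32 (2004), Thm. 4.7.
-/

noncomputable section

open Set Filter Topology MeasureTheory ProbabilityTheory Metric Complex
open UpperHalfPlane (upperHalfPlaneSet isOpen_upperHalfPlaneSet)
open scoped NNReal ENNReal

namespace Literature.Probability.RandomPlanarGeometry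

open Loewner

variable {κ : ℝ≥0}

/-- **A sealed half-disc at time `1` with positive probability, `κ ≥ 8`, from the trace and
Cor. 5.3** (the contradiction of Rohde–Schramm (2005), proof of Lemma 7.3, case `κ > 8`, p. 910,
as proved in `SLETransienceKappaEight.lean`): if SLE_κ, `κ ≥ 8`, is a.s. generated by a curve and
for every `t` almost surely `area(∂Kₜ) = 0` (hypothesis `hbd`, Cor. 5.3 at `κ`), then
`P[K₁ ⊇ {z ∈ ℍ : |z| < ε} for some ε > 0] ≠ 0`. Otherwise a.s. `0 ∈ cl H₁`
(`Loewner.zero_mem_closure_domain` form of the complement), every hull would be a.s. null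
(`ae_volume_sleHull_eq_zero_of_frontier`), which is absurd (`not_forall_ae_volume_sleHull_eq_zero`).
[cite: RohdeSchramm2005, Lemma 7.3] -/
theorem measure_halfDisc_sleHull_one_ne_zero_of_frontier_null (h0 : HasSLETrace κ) (hκ : 8 ≤ κ)
    (hbd : ∀ t : ℝ≥0, ∀ᵐ ω ∂Process.preWienerMeasure, volume (frontier (sleHull κ ω t)) = 0) :
    Process.preWienerMeasure
      {ω | ∃ ε : ℝ, 0 < ε ∧ {z ∈ upperHalfPlaneSet | ‖z‖ < ε} ⊆ sleHull κ ω 1} ≠ 0 := by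
  intro hzero
  -- `hzero`: a.s. no half-disc about `0` is contained in `K₁`, i.e. `0 ∈ cl H₁`
  have hbad : ∀ᵐ ω ∂Process.preWienerMeasure, (0 : ℂ) ∈ closure (domain (sleDriving κ ω) 1) := by
    filter_upwards [measure_eq_zero_iff_ae_notMem.1 hzero] with ω hω
    by_contra hcl
    refine hω ?_
    rw [Metric.mem_closure_iff] at hcl
    push Not at hcl
    obtain ⟨ε, hε, hfar⟩ := hcl
    refine ⟨ε, hε, fun z hz ↦ ?_⟩
    by_contra hzK
    have hzdom : z ∈ domain (sleDriving κ ω) 1 := ⟨hz.1, hzK⟩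
    have := hfar z hzdom
    rw [dist_comm, dist_zero_right] at this
    exact absurd hz.2 (not_lt.2 this)
  exact not_forall_ae_volume_sleHull_eq_zero h0 hκ
    (ae_volume_sleHull_eq_zero_of_frontier h0 hκ hbad hbd)

/-- **Rohde–Schramm (2005), Lemma 7.3 for `κ ≥ 8`, from the trace and Cor. 5.3**: if SLE_κ,
`κ ≥ 8`, is a.s. generated by a curve (`HasSLETrace κ`: Thm. 5.1 for `κ > 8`, [LSW] Thm. 4.7 at
`κ = 8`) and for every `t` almost surely `area(∂Kₜ) = 0` (Cor. 5.3 at `κ`, hypothesis `hbd`), then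
for every `t > 0`, almost surely `Kₜ ⊇ {z ∈ ℍ : |z| < ε}` for some `ε > 0`: positive probability
at time `1` (`measure_halfDisc_sleHull_one_ne_zero_of_frontier_null`), then scale invariance and
Blumenthal's zero-one law (`ae_exists_halfDisc_subset_sleHull_of_measure_ne_zero`), as on p. 910:
"The above argument implies that it is sufficient to show that there is some `t > 0` such that
with positive probability `0 ∉ cl Hₜ`." [cite: RohdeSchramm2005, Lemma 7.3] -/
theorem ae_exists_halfDisc_subset_sleHull_of_frontier_null (h0 : HasSLETrace κ) (hκ : 8 ≤ κ)
    (hbd : ∀ t : ℝ≥0, ∀ᵐ ω ∂Process.preWienerMeasure, volume (frontier (sleHull κ ω t)) = 0)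
    {t : ℝ≥0} (ht : 0 < t) :
    ∀ᵐ ω ∂Process.preWienerMeasure,
      ∃ ε : ℝ, 0 < ε ∧ {z ∈ upperHalfPlaneSet | ‖z‖ < ε} ⊆ sleHull κ ω t :=
  ae_exists_halfDisc_subset_sleHull_of_measure_ne_zero κ one_pos
    (measure_halfDisc_sleHull_one_ne_zero_of_frontier_null h0 hκ hbd) ht

/-- **`RohdeSchramm2005_lem73` from Thm. 5.1 and Cor. 5.3.** The named fact (Lemma 7.3: `κ > 4`,
`κ ≠ 8`, `t > 0` ⇒ a.s. `Kₜ ⊇ {z ∈ ℍ : |z| < ε}` for some `ε > 0`) follows from the existence of the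
trace for `κ ≠ 8` (`hasSLETrace_of_ne_eight`, Rohde–Schramm's Thm. 5.1; hypothesis `h51`) and,
for `κ > 8`, Cor. 5.3 (for every `t`, almost surely `area(∂Kₜ) = 0`; hypothesis `hbd`, stated on
the canonical space; not a named fact of the tree). The branch `4 < κ < 8` is
`RohdeSchramm2005_lem73_of_lt_eight` (Lemma 6.6, the Markov property, scaling and Blumenthal's
law), the branch `κ > 8` is `ae_exists_halfDisc_subset_sleHull_of_frontier_null` (Thm. 6.4,
Lemma 6.5, the Markov property, Fubini and Cor. 5.3), both along the printed proof (p. 910).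
[cite: RohdeSchramm2005, Lemma 7.3] -/
theorem RohdeSchramm2005_lem73_of_thm51_of_cor53 (h51 : hasSLETrace_of_ne_eight)
    (hbd : ∀ {κ : ℝ≥0}, 8 < κ → ∀ t : ℝ≥0,
      ∀ᵐ ω ∂Process.preWienerMeasure, volume (frontier (sleHull κ ω t)) = 0) :
    RohdeSchramm2005_lem73 := by
  intro κ hκ4 hκ8 t ht
  rcases lt_or_gt_of_ne hκ8 with hlt | hgt
  · exact RohdeSchramm2005_lem73_of_lt_eight h51 hκ4 hlt ht
  · exact ae_exists_halfDisc_subset_sleHull_of_frontier_null (h51 hκ8) hgt.le (hbd hgt) ht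

/-- The same with the trace supplied by Rohde–Schramm's Cor. 3.5 (`RohdeSchramm2005_cor35`,
through which SLE_κ, `κ ≠ 8`, is a.s. generated by a curve: `hasSLETrace_of_ne_eight_of_cor35`).
[cite: RohdeSchramm2005, Lemma 7.3] -/
theorem RohdeSchramm2005_lem73_of_cor35_of_cor53 (h35 : RohdeSchramm2005_cor35 Process.preWienerMeasure)
    (hbd : ∀ {κ : ℝ≥0}, 8 < κ → ∀ t : ℝ≥0,
      ∀ᵐ ω ∂Process.preWienerMeasure, volume (frontier (sleHull κ ω t)) = 0) :
    RohdeSchramm2005_lem73 :=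
  RohdeSchramm2005_lem73_of_thm51_of_cor53 (fun h8 ↦ hasSLETrace_of_ne_eight_of_cor35 h35 h8) hbd

/-! ### Discharge: Cor. 5.3 (`κ ≥ 8`) and Thm. 5.1 are theorems of the tree -/

/-- **Rohde–Schramm (2005), Lemma 7.3 for every `κ ≥ 8` whose chain is a.s. generated by a
curve** (`HasSLETrace κ`: a theorem for `κ > 8`, `hasSLETrace_of_ne_eight_apply`; [LSW] Thm. 4.7 at
`κ = 8`, where this is the content of the Update on p. 911): for every `t > 0`, almost surely
`Kₜ ⊇ {z ∈ ℍ : |z| < ε}` for some `ε > 0`. The Cor. 5.3 hypothesis of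
`ae_exists_halfDisc_subset_sleHull_of_frontier_null` (for every `t`, a.s. `area(∂Kₜ) = 0`) is the
theorem `ae_volume_frontier_sleHull_eq_zero_of_cor35` fed with `RohdeSchramm2005_cor35_holds`.
[cite: RohdeSchramm2005, Lemma 7.3 (p. 910) and Update (p. 911)] -/
theorem ae_exists_halfDisc_subset_sleHull_of_eight_le (h0 : HasSLETrace κ) (hκ : 8 ≤ κ)
    {t : ℝ≥0} (ht : 0 < t) :
    ∀ᵐ ω ∂Process.preWienerMeasure,
      ∃ ε : ℝ, 0 < ε ∧ {z ∈ upperHalfPlaneSet | ‖z‖ < ε} ⊆ sleHull κ ω t :=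
  ae_exists_halfDisc_subset_sleHull_of_frontier_null h0 hκ
    (ae_volume_frontier_sleHull_eq_zero_of_cor35 (RohdeSchramm2005_cor35_holds _) hκ h0) ht

/-- **Rohde–Schramm (2005), Lemma 7.3, holds** (p. 910: "Suppose that `κ > 4`, `κ ≠ 8`, and let
`t > 0`. Then a.s. there is some `ε > 0` such that `Kₜ ⊃ {z ∈ ℍ : |z| < ε}`"): the named fact
`RohdeSchramm2005_lem73` of `SLETransience.lean`, discharged. Assembly
`RohdeSchramm2005_lem73_of_thm51_of_cor53` of the two printed branches — `4 < κ < 8`: Thm. 5.1,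
Lemma 6.6, the Markov property, scaling and Blumenthal's 0-1 law (`SLETransienceLemma73.lean`);
`κ > 8`: Thm. 6.4, Lemma 6.5, the Markov property, Fubini and Cor. 5.3
(`SLETransienceKappaEight.lean`) — with Thm. 5.1 supplied by `hasSLETrace_of_ne_eight_holds` and
Cor. 5.3 (`κ > 8`) by `ae_volume_frontier_sleHull_eq_zero_of_cor35`, both resting on Cor. 3.5
(`RohdeSchramm2005_cor35_holds`). [cite: RohdeSchramm2005, Lemma 7.3 (p. 910)] -/
theorem RohdeSchramm2005_lem73_holds : RohdeSchramm2005_lem73 :=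
  RohdeSchramm2005_lem73_of_thm51_of_cor53 hasSLETrace_of_ne_eight_holds fun hκ t ↦
    ae_volume_frontier_sleHull_eq_zero_of_cor35 (RohdeSchramm2005_cor35_holds _) hκ.le
      (hasSLETrace_of_ne_eight_holds hκ.ne') t

/-- Lemma 7.3 applied: for `κ > 4`, `κ ≠ 8` and `t > 0`, almost surely the SLE_κ hull `Kₜ`
contains a half-disc `{z ∈ ℍ : |z| < ε}`, `ε > 0`, unconditionally.
[cite: RohdeSchramm2005, Lemma 7.3 (p. 910)] -/
theorem ae_exists_halfDisc_subset_sleHull_of_four_lt (hκ4 : 4 < κ) (hκ8 : κ ≠ 8) {t : ℝ≥0}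
    (ht : 0 < t) :
    ∀ᵐ ω ∂Process.preWienerMeasure,
      ∃ ε : ℝ, 0 < ε ∧ {z ∈ upperHalfPlaneSet | ‖z‖ < ε} ⊆ sleHull κ ω t :=
  RohdeSchramm2005_lem73_holds hκ4 hκ8 ht

end Literature.Probability.RandomPlanarGeometry
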